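import Literature.Analysis.FunctionSpaces.TorusTrilinearH1
import Literature.Analysis.FunctionSpaces.TorusLowOrderLeibniz
import Summits.NavierStokesRegularity.FunctionalMining.VelocityL4HalfRoot
import HarnessLib

/-!
# FunctionalMining — an EXPLICIT nonlinear Poincaré inequality `∫|u|⁴ ≤ C ∫|u|²|∇u|²` for
# zero-mean fields on the flat torus (the coercive step of the `L⁴` velocity-moment law)

search for candidate a priori estimates; no regularity claim. Cell `pub-nsfunc`, prove seat
(gen 8). Nothing here concerns Navier–Stokes solutions: this is a static functional inequality.

For a smooth zero-mean vector field `u : T^d → ℝ^d` (any finite index type `d`),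

  `∫ ‖u‖⁴ ≤ 1968 · d³ · ∫ ‖u‖² ∑ₖ ‖∂ₖu‖²`            (`integral_norm_pow_four_le`).

This is the case `a = 1` of the no-go seat's Lemma (NP) ("nonlinear Poincaré", SIEVELD.md §3.1:
`∫|v|^{2a+2} ≤ C ∫|v|^{2a}|∇v|²` for zero-mean `v`), which there is proved by COMPACTNESS (Rellich)
with an inexplicit constant; it is the coercive input `D₀ ≥ c F` of the saturating law for the
velocity moment `U₄ = ∫|u|⁴` (K0 row `EV.s=4|T_LD|G1`, companion file `VelocityL4SaturatingLaw`).
The LINEAR Poincaré inequality for `|u|²` is false on zero-mean fields (`u = (sin 2πz, cos 2πz, 0)`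
has `|u| ≡ 1`), so the mean-zero hypothesis must enter nonlinearly.

PROOF (constructive, new here). Put `W := ‖u‖·u`, so `∫‖W‖² = ∫‖u‖⁴`, and let `g(w) := w/√‖w‖`
the inverse of `u ↦ ‖u‖u`: `g(W(x)) = u(x)`. The map `g` is `½`-Hölder,
`‖g a − g b‖ ≤ 3 √‖a − b‖` (`norm_halfRoot_sub_le`). With `c := ∫ W` and `∫ u = 0`,
`g(c) = ∫ (g(c) − g(W))`, hence `√‖c‖ ≤ 3 ∫ √‖W − c‖ ≤ 3 (∫‖W − c‖²)^{1/4}` (Jensen twice), i.e.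
`‖c‖² ≤ 81 ∫‖W − c‖²` (`norm_sq_integral_le`), so `∫‖W‖² ≤ 164 ∫‖W − c‖²`: the mean of `W` is
controlled by its oscillation. The oscillation is controlled by Poincaré–Wirtinger applied to the
SMOOTH regularisation `W_ε := √(‖u‖²+ε)·u` (`‖W_ε − W‖ ≤ √ε‖u‖`, `∑ₖ‖∂ₖW_ε‖² ≤ 4(‖u‖²+ε)∑ₖ‖∂ₖu‖²`,
tree `Torus.integral_norm_sq_le_card_pow_mul_gradNormSq`), and `ε → 0` (the bound is affine in `ε`).
[ours; elementary]
-/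

noncomputable section

open MeasureTheory Finset
open scoped InnerProductSpace RealInnerProductSpace ContDiff

namespace Summit.NavierStokesRegularity.FunctionalMining

open Literature.Analysis.FunctionSpaces Literature.Analysis.FunctionSpaces.Torus

namespace VelocityL4


/-! ## 1. The smooth regularisation `W_ε = √(‖u‖² + ε) · u` -/

section Regularisation

variable {d : Type*} [Fintype d] [DecidableEq d]

omit [Fintype d] in
/-- Partial derivatives of constants vanish. [folklore] -/
private theorem partialDeriv_const_apply' {F : Type*} [NormedAddCommGroup F]
    [NormedSpace ℝ F] (c : F) (l : d) (x : UnitAddTorus d) :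
    partialDeriv l (fun _ : UnitAddTorus d => c) x = 0 := by
  simp [Torus.partialDeriv, Torus.lineDeriv]

/-- `√(p + q) ≤ √p + √q` for `p, q ≥ 0` (private copy; the same statement is
`Literature.NumberTheory.LFunctions.MRT2015.sqrt_add_le_sqrt_add_sqrt`, not imported here).
[folklore] -/
private theorem sqrt_add_le' {p q : ℝ} (hp : 0 ≤ p) (hq : 0 ≤ q) :
    Real.sqrt (p + q) ≤ Real.sqrt p + Real.sqrt q := by
  rw [Real.sqrt_le_left (by positivity)]
  have h1 := Real.sq_sqrt hp
  have h2 := Real.sq_sqrt hq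
  nlinarith [Real.sqrt_nonneg p, Real.sqrt_nonneg q]

omit [DecidableEq d] in
/-- The radial weight `√(‖u‖² + ε)` is smooth for `ε > 0`. [folklore] -/
theorem isSmooth_sqrt_normSq_add {u : UnitAddTorus d → EuclideanSpace ℝ d} (hu : IsSmooth u)
    {ε : ℝ} (hε : 0 < ε) : IsSmooth (fun x => Real.sqrt (‖u x‖ ^ 2 + ε)) := by
  have hw : IsSmooth (fun x => ‖u x‖ ^ 2 + ε) := by
    have h := (hu.norm_sq).add (isSmooth_const (d := d) (c := ε))
    exact h
  have hφ : ContDiffOn ℝ ∞ Real.sqrt (Set.Ioi 0) := fun y hy =>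
    (Real.contDiffAt_sqrt (ne_of_gt hy)).contDiffWithinAt
  exact IsSmooth.comp_of_contDiffOn hφ hw fun x => by
    show 0 < ‖u x‖ ^ 2 + ε
    positivity

omit [DecidableEq d] in
/-- `W_ε = √(‖u‖² + ε) · u` is smooth. [folklore] -/
theorem isSmooth_reg {u : UnitAddTorus d → EuclideanSpace ℝ d} (hu : IsSmooth u) {ε : ℝ}
    (hε : 0 < ε) : IsSmooth (fun x => Real.sqrt (‖u x‖ ^ 2 + ε) • u x) :=
  (isSmooth_sqrt_normSq_add hu hε).smul' hu

/-- The partial derivatives of the radial weight: `∂ₖ√(‖u‖²+ε) = ⟪u, ∂ₖu⟫ / √(‖u‖²+ε)`.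
[folklore] -/
theorem partialDeriv_sqrt_normSq_add {u : UnitAddTorus d → EuclideanSpace ℝ d} (hu : IsSmooth u)
    {ε : ℝ} (hε : 0 < ε) (k : d) (x : UnitAddTorus d) :
    partialDeriv k (fun y => Real.sqrt (‖u y‖ ^ 2 + ε)) x =
      ⟪u x, partialDeriv k u x⟫ / Real.sqrt (‖u x‖ ^ 2 + ε) := by
  have hw : IsSmooth (fun y => ‖u y‖ ^ 2 + ε) := (hu.norm_sq).add (isSmooth_const (d := d) (c := ε))
  have hpos : ∀ y, 0 < ‖u y‖ ^ 2 + ε := fun y => by positivity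
  have hφ : ContDiffOn ℝ ∞ Real.sqrt (Set.Ioi 0) := fun y hy =>
    (Real.contDiffAt_sqrt (ne_of_gt hy)).contDiffWithinAt
  have h := partialDeriv_comp_of_contDiffOn hφ isOpen_Ioi hw (fun y => hpos y) k x
  have hderiv : deriv Real.sqrt (‖u x‖ ^ 2 + ε) = 1 / (2 * Real.sqrt (‖u x‖ ^ 2 + ε)) :=
    (Real.hasDerivAt_sqrt (hpos x).ne').deriv
  -- `∂ₖ(‖u‖² + ε) = 2⟪u, ∂ₖu⟫`
  have hu1 : IsContDiff 1 u := hu.isContDiff (by simp)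
  have hsq : partialDeriv k (fun y => ‖u y‖ ^ 2 + ε) x = 2 * ⟪u x, partialDeriv k u x⟫ := by
    have e : (fun y => ‖u y‖ ^ 2 + ε) = (fun y => ⟪u y, u y⟫) + fun _ => ε := by
      funext y; simp only [Pi.add_apply, real_inner_self_eq_norm_sq]
    have hcst : IsContDiff 1 (fun _ : UnitAddTorus d => ε) := contDiff_const
    have hinn : IsContDiff 1 (fun y => ⟪u y, u y⟫) := ContDiff.inner ℝ hu1 hu1
    rw [e, partialDeriv_add hinn hcst, Pi.add_apply,
      partialDeriv_inner hu1 hu1, partialDeriv_const_apply', add_zero,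
      real_inner_comm (partialDeriv k u x) (u x)]
    ring
  change partialDeriv k (fun z => Real.sqrt ((fun y => ‖u y‖ ^ 2 + ε) z)) x = _
  rw [h, hderiv, hsq]
  have hs : Real.sqrt (‖u x‖ ^ 2 + ε) ≠ 0 := (Real.sqrt_pos.2 (hpos x)).ne'
  field_simp

/-- Derivative bound for the regularisation: `‖∂ₖW_ε‖ ≤ 2 √(‖u‖²+ε) ‖∂ₖu‖`. [ours] -/
theorem norm_partialDeriv_reg_le {u : UnitAddTorus d → EuclideanSpace ℝ d} (hu : IsSmooth u)
    {ε : ℝ} (hε : 0 < ε) (k : d) (x : UnitAddTorus d) :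
    ‖partialDeriv k (fun y => Real.sqrt (‖u y‖ ^ 2 + ε) • u y) x‖ ≤
      2 * Real.sqrt (‖u x‖ ^ 2 + ε) * ‖partialDeriv k u x‖ := by
  have hθ : IsContDiff 1 (fun y => Real.sqrt (‖u y‖ ^ 2 + ε)) :=
    (isSmooth_sqrt_normSq_add hu hε).isContDiff (by simp)
  have hu1 : IsContDiff 1 u := hu.isContDiff (by simp)
  rw [partialDeriv_smul hθ hu1, partialDeriv_sqrt_normSq_add hu hε]
  set s := Real.sqrt (‖u x‖ ^ 2 + ε) with hs
  have hpos : 0 < ‖u x‖ ^ 2 + ε := by positivity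
  have hs0 : 0 < s := Real.sqrt_pos.2 hpos
  have hus : ‖u x‖ ≤ s := by
    rw [hs]
    calc ‖u x‖ = Real.sqrt (‖u x‖ ^ 2) := (Real.sqrt_sq (norm_nonneg _)).symm
      _ ≤ Real.sqrt (‖u x‖ ^ 2 + ε) := Real.sqrt_le_sqrt (by linarith)
  have h1 : ‖s • partialDeriv k u x‖ = s * ‖partialDeriv k u x‖ := by
    rw [norm_smul, Real.norm_of_nonneg hs0.le]
  have h2 : ‖(⟪u x, partialDeriv k u x⟫ / s) • u x‖ ≤ s * ‖partialDeriv k u x‖ := by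
    rw [norm_smul, Real.norm_eq_abs, abs_div, abs_of_pos hs0]
    have hcs : |⟪u x, partialDeriv k u x⟫| ≤ ‖u x‖ * ‖partialDeriv k u x‖ :=
      abs_real_inner_le_norm _ _
    calc |⟪u x, partialDeriv k u x⟫| / s * ‖u x‖
        ≤ ‖u x‖ * ‖partialDeriv k u x‖ / s * ‖u x‖ := by gcongr
      _ = ‖u x‖ * ‖u x‖ / s * ‖partialDeriv k u x‖ := by ring
      _ ≤ s * s / s * ‖partialDeriv k u x‖ := by gcongr
      _ = s * ‖partialDeriv k u x‖ := by field_simp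
  calc ‖s • partialDeriv k u x + (⟪u x, partialDeriv k u x⟫ / s) • u x‖
      ≤ ‖s • partialDeriv k u x‖ + ‖(⟪u x, partialDeriv k u x⟫ / s) • u x‖ := norm_add_le _ _
    _ ≤ s * ‖partialDeriv k u x‖ + s * ‖partialDeriv k u x‖ := by rw [h1]; gcongr
    _ = 2 * s * ‖partialDeriv k u x‖ := by ring

/-- `gradNormSq W_ε ≤ 4 ∫ (‖u‖² + ε) ∑ₖ ‖∂ₖu‖²`. [ours] -/
theorem gradNormSq_reg_le {u : UnitAddTorus d → EuclideanSpace ℝ d} (hu : IsSmooth u)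
    {ε : ℝ} (hε : 0 < ε) :
    gradNormSq (fun y => Real.sqrt (‖u y‖ ^ 2 + ε) • u y) ≤
      4 * ∫ x, (‖u x‖ ^ 2 + ε) * ∑ k, ‖partialDeriv k u x‖ ^ 2 := by
  unfold gradNormSq
  have hW := isSmooth_reg hu hε
  have hc1 : Continuous fun x => ∑ k, ‖partialDeriv k (fun y => Real.sqrt (‖u y‖ ^ 2 + ε) • u y) x‖ ^ 2 :=
    continuous_finsetSum _ fun k _ => (hW.partialDeriv k).continuous.norm.pow 2
  have hc2 : Continuous fun x => (‖u x‖ ^ 2 + ε) * ∑ k, ‖partialDeriv k u x‖ ^ 2 :=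
    ((hu.continuous.norm.pow 2).add continuous_const).mul
      (continuous_finsetSum _ fun k _ => (hu.partialDeriv k).continuous.norm.pow 2)
  rw [← integral_const_mul]
  refine integral_mono hc1.integrable_unitAddTorus (hc2.integrable_unitAddTorus.const_mul 4)
    fun x => ?_
  simp only
  rw [Finset.mul_sum, Finset.mul_sum]
  refine Finset.sum_le_sum fun k _ => ?_
  have h := norm_partialDeriv_reg_le hu hε k x
  have hpos : 0 ≤ ‖u x‖ ^ 2 + ε := by positivity
  have hs := Real.sq_sqrt hpos
  have h0 : 0 ≤ ‖partialDeriv k (fun y => Real.sqrt (‖u y‖ ^ 2 + ε) • u y) x‖ := norm_nonneg _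
  calc ‖partialDeriv k (fun y => Real.sqrt (‖u y‖ ^ 2 + ε) • u y) x‖ ^ 2
      ≤ (2 * Real.sqrt (‖u x‖ ^ 2 + ε) * ‖partialDeriv k u x‖) ^ 2 := pow_le_pow_left₀ h0 h 2
    _ = 4 * ((‖u x‖ ^ 2 + ε) * ‖partialDeriv k u x‖ ^ 2) := by rw [mul_pow, mul_pow, hs]; ring

omit [DecidableEq d] in
/-- `‖W_ε − W‖ ≤ √ε ‖u‖` pointwise (`√(‖u‖²+ε) − ‖u‖ ≤ √ε`). [ours] -/
theorem norm_reg_sub_le (u : UnitAddTorus d → EuclideanSpace ℝ d) {ε : ℝ} (hε : 0 < ε)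
    (x : UnitAddTorus d) :
    ‖Real.sqrt (‖u x‖ ^ 2 + ε) • u x - ‖u x‖ • u x‖ ≤ Real.sqrt ε * ‖u x‖ := by
  rw [← sub_smul, norm_smul, Real.norm_eq_abs]
  have h1 : Real.sqrt (‖u x‖ ^ 2 + ε) ≤ ‖u x‖ + Real.sqrt ε := by
    have := sqrt_add_le' (sq_nonneg ‖u x‖) hε.le
    rwa [Real.sqrt_sq (norm_nonneg _)] at this
  have h2 : ‖u x‖ ≤ Real.sqrt (‖u x‖ ^ 2 + ε) :=
    calc ‖u x‖ = Real.sqrt (‖u x‖ ^ 2) := (Real.sqrt_sq (norm_nonneg _)).symm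
      _ ≤ Real.sqrt (‖u x‖ ^ 2 + ε) := Real.sqrt_le_sqrt (by linarith)
  have h3 : |Real.sqrt (‖u x‖ ^ 2 + ε) - ‖u x‖| ≤ Real.sqrt ε := by
    rw [abs_of_nonneg (by linarith)]; linarith
  exact mul_le_mul_of_nonneg_right h3 (norm_nonneg _)

end Regularisation

/-! ## 2. The nonlinear Poincaré inequality -/

section Main

variable {d : Type*} [Fintype d] [DecidableEq d]

/-- **Explicit nonlinear Poincaré inequality (case `a = 1` of SIEVELD Lemma NP).** For every
smooth zero-mean vector field `u` on the flat torus `T^d`,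
`∫ ‖u‖⁴ ≤ 1968 · d³ · ∫ ‖u‖² ∑ₖ ‖∂ₖu‖²`.
The constant is not optimised (`1968 d³ = 164 · 3 · 4 · d³`: mean control `164`, three-term
splitting `3`, regularised gradient `4`, Poincaré–Wirtinger `d³`). [ours; elementary] -/
theorem integral_norm_pow_four_le {u : UnitAddTorus d → EuclideanSpace ℝ d} (hu : IsSmooth u)
    (h0 : HasZeroMean u) :
    ∫ x, ‖u x‖ ^ 4 ≤
      1968 * (Fintype.card d : ℝ) ^ 3 * ∫ x, ‖u x‖ ^ 2 * ∑ k, ‖partialDeriv k u x‖ ^ 2 := by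
  -- notation
  set W : UnitAddTorus d → EuclideanSpace ℝ d := fun x => ‖u x‖ • u x with hW
  set c : EuclideanSpace ℝ d := ∫ x, W x with hc
  set I : ℝ := ∫ x, ‖u x‖ ^ 2 * ∑ k, ‖partialDeriv k u x‖ ^ 2 with hI
  set K : ℝ := ∫ x, ‖u x‖ ^ 2 with hK
  set Z : ℝ := gradNormSq u with hZ
  set D3 : ℝ := (Fintype.card d : ℝ) ^ 3 with hD3
  have huc : Continuous u := hu.continuous
  have hWc : Continuous W := huc.norm.smul huc
  have h0' : ∫ x, u x = 0 := h0
  have hI0 : 0 ≤ I := integral_nonneg fun x => by positivity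
  have hK0 : 0 ≤ K := integral_nonneg fun x => by positivity
  have hZ0 : 0 ≤ Z := gradNormSq_nonneg u
  have hD30 : 0 ≤ D3 := by positivity
  -- `U = ∫‖W‖²`
  have hU : ∫ x, ‖u x‖ ^ 4 = ∫ x, ‖W x‖ ^ 2 := by
    refine integral_congr_ae (ae_of_all _ fun x => ?_)
    simp only [hW, norm_smul, Real.norm_of_nonneg (norm_nonneg _)]; ring
  -- mean control: `‖c‖² ≤ 81 V`
  set V : ℝ := ∫ x, ‖W x - c‖ ^ 2 with hV
  have hmean : ‖c‖ ^ 2 ≤ 81 * V := norm_sq_integral_le huc h0'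
  -- `U ≤ 2V + 2‖c‖² ≤ 164 V`
  have hUV : ∫ x, ‖W x‖ ^ 2 ≤ 164 * V := by
    have hpt : ∀ x, ‖W x‖ ^ 2 ≤ 2 * ‖W x - c‖ ^ 2 + 2 * ‖c‖ ^ 2 := by
      intro x
      have h := norm_add_le (W x - c) c
      rw [sub_add_cancel] at h
      have h2 : ‖W x‖ ^ 2 ≤ (‖W x - c‖ + ‖c‖) ^ 2 := pow_le_pow_left₀ (norm_nonneg _) h 2
      nlinarith [sq_nonneg (‖W x - c‖ - ‖c‖)]
    have hcV : Continuous fun x => ‖W x - c‖ ^ 2 := (hWc.sub continuous_const).norm.pow 2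
    have hiV : Integrable (fun x => 2 * ‖W x - c‖ ^ 2) volume :=
      (hcV.const_mul 2).integrable_unitAddTorus
    have hic : Integrable (fun _ : UnitAddTorus d => 2 * ‖c‖ ^ 2) volume := integrable_const _
    have hi1 : Integrable (fun x => 2 * ‖W x - c‖ ^ 2 + 2 * ‖c‖ ^ 2) volume := hiV.add hic
    have hiW : Integrable (fun x => ‖W x‖ ^ 2) volume := (hWc.norm.pow 2).integrable_unitAddTorus
    calc ∫ x, ‖W x‖ ^ 2 ≤ ∫ x, (2 * ‖W x - c‖ ^ 2 + 2 * ‖c‖ ^ 2) := integral_mono hiW hi1 hpt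
      _ = 2 * V + 2 * ‖c‖ ^ 2 := by
          rw [integral_add hiV hic, integral_const_mul, integral_const]
          simp [hV]
      _ ≤ 164 * V := by linarith
  -- for every `ε > 0`: `V ≤ 12 D3 I + ε (6K + 12 D3 Z)`
  have hVε : ∀ ε : ℝ, 0 < ε → V ≤ 12 * D3 * I + ε * (6 * K + 12 * D3 * Z) := by
    intro ε hε
    set Wε : UnitAddTorus d → EuclideanSpace ℝ d := fun x => Real.sqrt (‖u x‖ ^ 2 + ε) • u x
      with hWε
    set cε : EuclideanSpace ℝ d := ∫ x, Wε x with hcε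
    have hWεs : IsSmooth Wε := isSmooth_reg hu hε
    have hWεc : Continuous Wε := hWεs.continuous
    -- (a) `∫‖Wε − W‖² ≤ ε K`
    have ha : ∫ x, ‖Wε x - W x‖ ^ 2 ≤ ε * K := by
      have hpt : ∀ x, ‖Wε x - W x‖ ^ 2 ≤ ε * ‖u x‖ ^ 2 := by
        intro x
        have h := norm_reg_sub_le u hε x
        have hs := Real.sq_sqrt hε.le
        calc ‖Wε x - W x‖ ^ 2 ≤ (Real.sqrt ε * ‖u x‖) ^ 2 :=
              pow_le_pow_left₀ (norm_nonneg _) h 2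
          _ = ε * ‖u x‖ ^ 2 := by rw [mul_pow, hs]
      calc ∫ x, ‖Wε x - W x‖ ^ 2 ≤ ∫ x, ε * ‖u x‖ ^ 2 :=
            integral_mono ((hWεc.sub hWc).norm.pow 2).integrable_unitAddTorus
              ((huc.norm.pow 2).integrable_unitAddTorus.const_mul ε) hpt
        _ = ε * K := integral_const_mul _ _
    -- (b) `‖cε − c‖² ≤ ε K`
    have hb : ‖cε - c‖ ^ 2 ≤ ε * K := by
      have e : cε - c = ∫ x, (Wε x - W x) := by
        rw [hcε, hc, integral_sub hWεc.integrable_unitAddTorus hWc.integrable_unitAddTorus]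
      have h1 : ‖cε - c‖ ≤ ∫ x, ‖Wε x - W x‖ := by
        rw [e]; exact norm_integral_le_integral_norm _
      have h2 : ∫ x, ‖Wε x - W x‖ ≤ Real.sqrt (∫ x, ‖Wε x - W x‖ ^ 2) :=
        integral_le_sqrt_integral_sq (hWεc.sub hWc).norm
      have h3 : 0 ≤ ∫ x, ‖Wε x - W x‖ ^ 2 := integral_nonneg fun x => sq_nonneg _
      have hs := Real.sq_sqrt h3
      have h4 : ‖cε - c‖ ≤ Real.sqrt (∫ x, ‖Wε x - W x‖ ^ 2) := h1.trans h2
      calc ‖cε - c‖ ^ 2 ≤ Real.sqrt (∫ x, ‖Wε x - W x‖ ^ 2) ^ 2 :=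
            pow_le_pow_left₀ (norm_nonneg _) h4 2
        _ = ∫ x, ‖Wε x - W x‖ ^ 2 := hs
        _ ≤ ε * K := ha
    -- (c) Poincaré–Wirtinger for `Wε − cε`: `∫‖Wε − cε‖² ≤ D3 · 4 (I + ε Z)`
    have hcP : ∫ x, ‖Wε x - cε‖ ^ 2 ≤ D3 * (4 * (I + ε * Z)) := by
      have hsm : IsSmooth (fun x => Wε x - cε) := hWεs.sub (isSmooth_const cε)
      have hzm : HasZeroMean (fun x => Wε x - cε) := by
        show ∫ x, (Wε x - cε) = 0
        rw [integral_sub hWεc.integrable_unitAddTorus (integrable_const _), integral_const]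
        simp [hcε]
      have hP := Torus.integral_norm_sq_le_card_pow_mul_gradNormSq hsm hzm
      have hg : gradNormSq (fun x => Wε x - cε) = gradNormSq Wε := by
        unfold gradNormSq
        refine integral_congr_ae (ae_of_all _ fun x => ?_)
        refine Finset.sum_congr rfl fun k _ => ?_
        have e : (fun x => Wε x - cε) = Wε + fun _ => -cε := by
          funext y; simp [sub_eq_add_neg]
        have hcst : IsContDiff 1 (fun _ : UnitAddTorus d => -cε) := contDiff_const
        rw [e, partialDeriv_add (hWεs.isContDiff (by simp)) hcst,
          Pi.add_apply, partialDeriv_const_apply', add_zero]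
      have hG : gradNormSq Wε ≤ 4 * (I + ε * Z) := by
        have h := gradNormSq_reg_le hu hε
        have e : ∫ x, (‖u x‖ ^ 2 + ε) * ∑ k, ‖partialDeriv k u x‖ ^ 2 = I + ε * Z := by
          have e1 : (fun x => (‖u x‖ ^ 2 + ε) * ∑ k, ‖partialDeriv k u x‖ ^ 2) =
              fun x => ‖u x‖ ^ 2 * ∑ k, ‖partialDeriv k u x‖ ^ 2 +
                ε * ∑ k, ‖partialDeriv k u x‖ ^ 2 := by
            funext x; ring
          have hcs : Continuous fun x => ∑ k, ‖partialDeriv k u x‖ ^ 2 :=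
            continuous_finsetSum _ fun k _ => (hu.partialDeriv k).continuous.norm.pow 2
          have hi1 : Integrable (fun x => ‖u x‖ ^ 2 * ∑ k, ‖partialDeriv k u x‖ ^ 2) volume :=
            ((huc.norm.pow 2).mul hcs).integrable_unitAddTorus
          have hi2 : Integrable (fun x => ε * ∑ k, ‖partialDeriv k u x‖ ^ 2) volume :=
            hcs.integrable_unitAddTorus.const_mul ε
          rw [e1, integral_add hi1 hi2, integral_const_mul]
          rfl
        rw [e] at h; exact h
      calc ∫ x, ‖Wε x - cε‖ ^ 2 ≤ (Fintype.card d : ℝ) ^ 3 * gradNormSq (fun x => Wε x - cε) := hP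
        _ = D3 * gradNormSq Wε := by rw [hg]
        _ ≤ D3 * (4 * (I + ε * Z)) := mul_le_mul_of_nonneg_left hG hD30
    -- (d) three-term splitting
    have hsplit : V ≤ 3 * (∫ x, ‖Wε x - W x‖ ^ 2) + 3 * (∫ x, ‖Wε x - cε‖ ^ 2) +
        3 * ‖cε - c‖ ^ 2 := by
      have hpt : ∀ x, ‖W x - c‖ ^ 2 ≤
          3 * ‖Wε x - W x‖ ^ 2 + 3 * ‖Wε x - cε‖ ^ 2 + 3 * ‖cε - c‖ ^ 2 := by
        intro x
        have e : W x - c = (Wε x - cε) + (cε - c) - (Wε x - W x) := by abel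
        have h1 := norm_sub_le ((Wε x - cε) + (cε - c)) (Wε x - W x)
        have h2 := norm_add_le (Wε x - cε) (cε - c)
        rw [← e] at h1
        have h3 : ‖W x - c‖ ≤ ‖Wε x - W x‖ + ‖Wε x - cε‖ + ‖cε - c‖ := by linarith
        have h4 : ‖W x - c‖ ^ 2 ≤ (‖Wε x - W x‖ + ‖Wε x - cε‖ + ‖cε - c‖) ^ 2 :=
          pow_le_pow_left₀ (norm_nonneg _) h3 2
        nlinarith [sq_nonneg (‖Wε x - W x‖ - ‖Wε x - cε‖), sq_nonneg (‖Wε x - cε‖ - ‖cε - c‖),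
          sq_nonneg (‖Wε x - W x‖ - ‖cε - c‖)]
      have hca : Continuous fun x => ‖Wε x - W x‖ ^ 2 := (hWεc.sub hWc).norm.pow 2
      have hcb : Continuous fun x => ‖Wε x - cε‖ ^ 2 := (hWεc.sub continuous_const).norm.pow 2
      have hia : Integrable (fun x => 3 * ‖Wε x - W x‖ ^ 2) volume :=
        (hca.const_mul 3).integrable_unitAddTorus
      have hib : Integrable (fun x => 3 * ‖Wε x - cε‖ ^ 2) volume :=
        (hcb.const_mul 3).integrable_unitAddTorus
      have hicc : Integrable (fun _ : UnitAddTorus d => 3 * ‖cε - c‖ ^ 2) volume :=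
        integrable_const _
      have hiab : Integrable (fun x => 3 * ‖Wε x - W x‖ ^ 2 + 3 * ‖Wε x - cε‖ ^ 2) volume :=
        hia.add hib
      have hi : Integrable (fun x => 3 * ‖Wε x - W x‖ ^ 2 + 3 * ‖Wε x - cε‖ ^ 2 +
          3 * ‖cε - c‖ ^ 2) volume := hiab.add hicc
      have hiV : Integrable (fun x => ‖W x - c‖ ^ 2) volume :=
        ((hWc.sub continuous_const).norm.pow 2).integrable_unitAddTorus
      calc V ≤ ∫ x, (3 * ‖Wε x - W x‖ ^ 2 + 3 * ‖Wε x - cε‖ ^ 2 + 3 * ‖cε - c‖ ^ 2) :=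
            integral_mono hiV hi hpt
        _ = 3 * (∫ x, ‖Wε x - W x‖ ^ 2) + 3 * (∫ x, ‖Wε x - cε‖ ^ 2) + 3 * ‖cε - c‖ ^ 2 := by
            rw [integral_add hiab hicc, integral_add hia hib, integral_const_mul, integral_const_mul,
              integral_const]
            simp
    -- (e) collect
    have hεK : 0 ≤ ε * K := mul_nonneg hε.le hK0
    nlinarith [hsplit, ha, hb, hcP, mul_nonneg hε.le hZ0]
  -- `ε → 0`
  have hVle : V ≤ 12 * D3 * I := by
    refine le_of_forall_pos_lt_add fun η hη => ?_
    set B : ℝ := 6 * K + 12 * D3 * Z with hB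
    have hB0 : 0 ≤ B := by positivity
    have h := hVε (η / (B + 1)) (by positivity)
    have h2 : η / (B + 1) * B < η := by
      rw [div_mul_eq_mul_div, div_lt_iff₀ (by positivity)]
      nlinarith
    linarith
  calc ∫ x, ‖u x‖ ^ 4 = ∫ x, ‖W x‖ ^ 2 := hU
    _ ≤ 164 * V := hUV
    _ ≤ 164 * (12 * D3 * I) := by gcongr
    _ = 1968 * (Fintype.card d : ℝ) ^ 3 * I := by rw [hD3]; ring

end Main

end VelocityL4

end Summit.NavierStokesRegularity.FunctionalMining
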